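import Mathlib
import Literature.Computability.Complexity.RangeAvoidance
import Summits.PneNP.PneNP.Theorems.PstarSALevel
import Summits.PneNP.PneNP.Theorems.PstarSASDPLevel
import Summits.PneNP.PneNP.Theorems.PstarSAClosure

/-!
# Boundary expansion at a general ratio: the closure (advice set) and the many-private-variables pigeonhole

FRONTIER range-avoidance ladder, rung F-N3 context (cell `pnp-ideate`, ROUND-21/22 item T22.1c′, first half; restricted-model
combinatorics — nothing here bears on `P` vs `NP`).  `PstarSAClosure.exists_closure` is BGMT's Theorem 3.1 with the ratios
`3/2 → 5/4` hard-wired (arity-4 outputs, peel with ≥ 2 private variables).  The block-level construction of the ROUND-22 seed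
(memo §12b: constraints of arity `K = t(t−1)`, peel with ≥ K − 2 private vertices, expansion ratio ≈ K − 2.5) needs the same two
facts at a general ratio, for the ratio-parametrised expansion `PstarSASDPLevel.BoundaryExpandingQ a b` (`a·|J| ≤ b·|bdry J|`):

* `exists_closureQ` — for any target ratio `a₂/b₂ < a/b` (i.e. `a₂ b < a b₂`, gap `g := a b₂ − a₂ b`): every `S` has a superset
  `S̄` with `g·|S̄| ≤ (g + k·b·b₂)·|S|` such that every non-empty family `M` of outputs not dominated by `S̄` with
  `g·|M| + b·b₂·|S| ≤ g·r` satisfies `a₂·|M| ≤ b₂·|bdry M ∖ S̄|` (same extremal proof: `S̄ = S ∪ N(M⋆)` for a maximum-cardinality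
  `M⋆` in `{M : |M| ≤ r, b₂·|bdry M ∖ S| ≤ a₂·|M|}`, and `g·|M⋆| ≤ b·b₂·|S|` by expansion);
* `exists_private_of_mul_lt` — if `d·|M| < |bdry M ∖ T|` then some member of `M` owns at least `d + 1` boundary variables of `M`
  outside `T` (for `d = K − 3` this is the block peel condition "≥ K − 2 private vertices");
* `exists_closure'` — the `3/2 → 5/4`, `d = 1` instance, recovering `PstarSAClosure.exists_peelable_of_closure`'s shape.
-/

set_option linter.dupNamespace false

open Finset Literature.Computability.Complexity
open Summit.PneNP.PneNP.Theorems.PstarSALevel (varSet bdry BoundaryExpanding)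
open Summit.PneNP.PneNP.Theorems.PstarSASDPLevel (BoundaryExpandingQ)
open Summit.PneNP.PneNP.Theorems.PstarSAClosure (nbhd degIn mem_bdry_iff card_nbhd_le bdry_union_sdiff_subset
  varSet_subset_nbhd)

namespace Summit.PneNP.PneNP.Theorems.PstarSAClosureQ

variable {k n m : ℕ}

/-- **The closure at a general ratio (BGMT Thm 3.1).**  If `I` is `(r, a/b)`-boundary expanding and `a₂/b₂ < a/b`, then every
`S` has a superset `S̄` with `(a b₂ − a₂ b)·|S̄| ≤ (a b₂ − a₂ b + k·b·b₂)·|S|` such that every non-empty family `M` of outputs not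
dominated by `S̄`, within the budget `(a b₂ − a₂ b)·|M| + b·b₂·|S| ≤ (a b₂ − a₂ b)·r`, satisfies `a₂·|M| ≤ b₂·|bdry M ∖ S̄|`. -/
theorem exists_closureQ (I : LocalMap k n m) (a b a₂ b₂ r : ℕ) (hab : a₂ * b < a * b₂)
    (hexp : BoundaryExpandingQ a b r I) (S : Finset (Fin n)) :
    ∃ Sb : Finset (Fin n), S ⊆ Sb ∧ (a * b₂ - a₂ * b) * Sb.card ≤ (a * b₂ - a₂ * b + k * (b * b₂)) * S.card ∧
      ∀ M : Finset (Fin m), M.Nonempty → (∀ j ∈ M, ¬ varSet I j ⊆ Sb) →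
        (a * b₂ - a₂ * b) * M.card + b * b₂ * S.card ≤ (a * b₂ - a₂ * b) * r →
        a₂ * M.card ≤ b₂ * (bdry I M \ Sb).card := by
  classical
  set g := a * b₂ - a₂ * b with hg
  have hgpos : 0 < g := by omega
  have hgab : g + a₂ * b = a * b₂ := by omega
  -- the family and a maximum-cardinality member
  set F : Finset (Finset (Fin m)) :=
    univ.filter fun M => M.card ≤ r ∧ b₂ * (bdry I M \ S).card ≤ a₂ * M.card with hF
  have hbd0 : bdry I (∅ : Finset (Fin m)) = ∅ := by
    ext v; simp [PstarSALevel.bdry]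
  have hFne : F.Nonempty := ⟨∅, by simp [hF, hbd0]⟩
  obtain ⟨Ms, hMsF, hmax⟩ := Finset.exists_max_image F Finset.card hFne
  have hMs : Ms.card ≤ r ∧ b₂ * (bdry I Ms \ S).card ≤ a₂ * Ms.card := by simpa [hF] using hMsF
  -- expansion bounds `|Ms|`: g·|Ms| ≤ b·b₂·|S|
  have hMs_le : g * Ms.card ≤ b * b₂ * S.card := by
    have h1 := hexp Ms hMs.1                                   -- a |Ms| ≤ b |bdry Ms|
    have h2 := Finset.card_le_card_sdiff_add_card (s := bdry I Ms) (t := S)  -- |bdry| ≤ |bdry \ S| + |S|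
    -- b₂·a·|Ms| ≤ b₂·b·|bdry| ≤ b·(b₂ |bdry \ S|) + b b₂ |S| ≤ b·a₂·|Ms| + b b₂ |S|
    have h3 : b₂ * (a * Ms.card) ≤ b * (b₂ * (bdry I Ms \ S).card) + b * b₂ * S.card := by
      have := Nat.mul_le_mul_left b₂ h1
      have h4 : b₂ * (b * (bdry I Ms).card) ≤ b₂ * (b * ((bdry I Ms \ S).card + S.card)) :=
        Nat.mul_le_mul_left _ (Nat.mul_le_mul_left _ h2)
      nlinarith
    have h5 : b * (b₂ * (bdry I Ms \ S).card) ≤ b * (a₂ * Ms.card) := Nat.mul_le_mul_left _ hMs.2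
    have h6 : g * Ms.card + a₂ * b * Ms.card = a * b₂ * Ms.card := by rw [← Nat.add_mul, hgab]
    nlinarith
  refine ⟨S ∪ nbhd I Ms, Finset.subset_union_left, ?_, ?_⟩
  · have h1 : (S ∪ nbhd I Ms).card ≤ S.card + k * Ms.card :=
      (Finset.card_union_le _ _).trans (by have := card_nbhd_le I Ms; omega)
    have h2 : g * (S ∪ nbhd I Ms).card ≤ g * S.card + k * (g * Ms.card) := by
      have := Nat.mul_le_mul_left g h1; nlinarith
    have h3 : k * (g * Ms.card) ≤ k * (b * b₂ * S.card) := Nat.mul_le_mul_left _ hMs_le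
    nlinarith
  · intro M hMne hnd hbudget
    by_contra hlt
    push Not at hlt
    have hdisj : Disjoint Ms M := by
      rw [Finset.disjoint_right]
      intro j hjM hjMs
      exact hnd j hjM ((varSet_subset_nbhd I hjMs).trans Finset.subset_union_right)
    have hcard : (Ms ∪ M).card = Ms.card + M.card := Finset.card_union_of_disjoint hdisj
    have hbd : (bdry I (Ms ∪ M) \ S).card ≤ (bdry I Ms \ S).card + (bdry I M \ (S ∪ nbhd I Ms)).card :=
      (Finset.card_le_card (bdry_union_sdiff_subset I Ms M S hdisj)).trans (Finset.card_union_le _ _)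
    have hsize : Ms.card + M.card ≤ r := by
      -- g(|Ms| + |M|) ≤ b b₂ |S| + g|M| ≤ g r
      have : g * (Ms.card + M.card) ≤ g * r := by nlinarith
      exact Nat.le_of_mul_le_mul_left this hgpos
    have hmem : Ms ∪ M ∈ F := by
      simp only [hF, Finset.mem_filter, Finset.mem_univ, true_and]
      refine ⟨by omega, ?_⟩
      have : b₂ * (bdry I (Ms ∪ M) \ S).card ≤ b₂ * ((bdry I Ms \ S).card + (bdry I M \ (S ∪ nbhd I Ms)).card) :=
        Nat.mul_le_mul_left _ hbd
      nlinarith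
    have hle := hmax _ hmem
    have hpos := hMne.card_pos
    omega

/-- **Pigeonhole, general form.**  If `d·|M| < |bdry M ∖ T|` then some member of `M` owns at least `d + 1` boundary variables of
`M` outside `T` (private to it and outside `T`). -/
theorem exists_private_of_mul_lt (I : LocalMap k n m) (M : Finset (Fin m)) (T : Finset (Fin n)) (d : ℕ)
    (h : d * M.card < (bdry I M \ T).card) :
    ∃ j ∈ M, d + 1 ≤ ((bdry I M \ T).filter fun v => v ∈ varSet I j).card := by
  classical
  by_contra hno
  push Not at hno
  have hcov : bdry I M \ T ⊆ M.biUnion fun j => (bdry I M \ T).filter fun v => v ∈ varSet I j := by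
    intro v hv
    have hv' := (Finset.mem_sdiff.1 hv).1
    rw [mem_bdry_iff] at hv'
    obtain ⟨j, hj⟩ : (M.filter fun j => v ∈ varSet I j).Nonempty := by
      rw [← Finset.card_pos]; unfold PstarSAClosure.degIn at hv'; omega
    rw [Finset.mem_filter] at hj
    exact Finset.mem_biUnion.2 ⟨j, hj.1, Finset.mem_filter.2 ⟨hv, hj.2⟩⟩
  have h1 := (Finset.card_le_card hcov).trans Finset.card_biUnion_le
  have hsum : ∑ j ∈ M, ((bdry I M \ T).filter fun v => v ∈ varSet I j).card ≤ ∑ _j ∈ M, d :=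
    Finset.sum_le_sum fun j hj => by have := hno j hj; omega
  rw [Finset.sum_const, smul_eq_mul] at hsum
  have : (bdry I M \ T).card ≤ M.card * d := h1.trans hsum
  rw [Nat.mul_comm] at this
  omega

/-- **Closure + pigeonhole at a general ratio.**  Under `(r, a/b)`-expansion and a target ratio `a₂/b₂ < a/b` with
`d·b₂ < a₂` (so that `a₂·|M| ≤ b₂·|bdry ∖ S̄|` forces `d·|M| < |bdry ∖ S̄|` for non-empty `M`), every non-empty non-dominated family
within budget has a member with at least `d + 1` private variables outside the closure. -/
theorem exists_peelable_of_closureQ (I : LocalMap k n m) (a b a₂ b₂ r d : ℕ) (hab : a₂ * b < a * b₂) (hd : d * b₂ < a₂)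
    (hexp : BoundaryExpandingQ a b r I) (S : Finset (Fin n)) :
    ∃ Sb : Finset (Fin n), S ⊆ Sb ∧ (a * b₂ - a₂ * b) * Sb.card ≤ (a * b₂ - a₂ * b + k * (b * b₂)) * S.card ∧
      ∀ M : Finset (Fin m), M.Nonempty → (∀ j ∈ M, ¬ varSet I j ⊆ Sb) →
        (a * b₂ - a₂ * b) * M.card + b * b₂ * S.card ≤ (a * b₂ - a₂ * b) * r →
        ∃ j ∈ M, d + 1 ≤ ((bdry I M \ Sb).filter fun v => v ∈ varSet I j).card := by
  obtain ⟨Sb, hS, hcard, hcl⟩ := exists_closureQ I a b a₂ b₂ r hab hexp S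
  refine ⟨Sb, hS, hcard, fun M hMne hnd hbudget => exists_private_of_mul_lt I M Sb d ?_⟩
  have h1 := hcl M hMne hnd hbudget
  have hpos := hMne.card_pos
  -- d·b₂·|M| < a₂·|M| ≤ b₂·|bdry ∖ Sb|
  have h2 : b₂ * (d * M.card) < b₂ * (bdry I M \ Sb).card := by
    calc b₂ * (d * M.card) = d * b₂ * M.card := by ring
      _ < a₂ * M.card := Nat.mul_lt_mul_of_pos_right hd hpos
      _ ≤ b₂ * (bdry I M \ Sb).card := h1
  exact Nat.lt_of_mul_lt_mul_left h2

/-- The `3/2 → 5/4`, `d = 1` instance: gap `g = 2`, `|S̄| ≤ |S| + 4k|S|`, budget `|M| + 4|S| ≤ r`, two private variables —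
the shape of `PstarSAClosure.exists_peelable_of_closure`, now derived from the general statement. -/
theorem exists_closure' (I : LocalMap k n m) (r : ℕ) (hexp : BoundaryExpanding r I) (S : Finset (Fin n)) :
    ∃ Sb : Finset (Fin n), S ⊆ Sb ∧ 2 * Sb.card ≤ (2 + k * 8) * S.card ∧
      ∀ M : Finset (Fin m), M.Nonempty → (∀ j ∈ M, ¬ varSet I j ⊆ Sb) → 2 * M.card + 8 * S.card ≤ 2 * r →
        ∃ j ∈ M, 2 ≤ ((bdry I M \ Sb).filter fun v => v ∈ varSet I j).card := by
  have hQ : BoundaryExpandingQ 3 2 r I := fun J hJ => hexp J hJ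
  have := exists_peelable_of_closureQ I 3 2 5 4 r 1 (by norm_num) (by norm_num) hQ S
  simpa using this

end Summit.PneNP.PneNP.Theorems.PstarSAClosureQ
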